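import Summits.QuantumFields.YangMills.Theorems.BalabanUVNodesN16HolderMSDictionary
import HarnessLib

/-!
# Route «BalabanUVNodes», cluster K4 «SpineRates» — node N16 = NE3: (OUT_print-MS) ⟹ (OUT₁₃₈-MS) — the last member dictionary of the N05 → N16 edge WITH
# THE MULTI-SCALE (3.40) HÖLDER MEMBER (repair R-β″, PRODUCER HALF): n16-a's `N16PrintLetters.thm4OutputLandau138_of_thm4OutputPrint` with print's (1.36)₃ line
# read along lattice lines at every separation `1 ≤ j ≤ L^k` and THE END's multi-scale member of `Z = Ad_{W⁻¹}(iηA)` added to the binder (brick 1 plugged in)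

Cell `pub-ymgap`, seat `pub-ymgap-dag-n16-c` (R134 fan-out seat, strategy s1; HUMAN RULING D-0062; chair R424 venue), generation 4, file 29 — twin of n16-a's
generation-4 file 11 §3 over brick 1 (`BalabanUVNodesN16HolderMSDictionary`).  `--supports stmt-QuantumFields-19912 --as helper` (K3‴ `SpineGivenEndpointR13`, route
rev 16).  `bears_on: R4∕N16 · edge N05 → N16`.  Located item: `HOME/pub-ymgap-dag-n16-c/LOCATED-N16-HOLDER-PIN.md`, census row R-β″ (ADDENDUM 5).

WHY.  n16-a's (OUT_print) carries print's (1.36)₃ at nearest-neighbour distance along `μ` («`‖Ad_{W(y,μ)}(D^η_{W,μ}A_κ)(y+e_μ) − D^η_{W,μ}A_κ(y)‖ ≤ hol·ξ^{kβ}`»)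
and (OUT₁₃₈) THE END's nearest-neighbour member of `Z = Ad_{W⁻¹}(iηA)` at `S₂ξ^{k(2+β)}`, `hol + 8α_{b′}s ≤ S₂`.  The multi-scale binders: (OUT_print-MS) =
(OUT_print) with the Hölder line read ALONG LATTICE LINES at every separation, «`‖Ad_{W(Γ_{y,y+j e_μ})}(D^η_{W,μ}A_κ)(y+j•e_μ) − D^η_{W,μ}A_κ(y)‖ ≤ hol·ξ^{kβ}·j^β`,
`1 ≤ j ≤ L^k`» (`W(Γ) = hol W y (seg μ j)`; brick 2 reads it off node N05's leaf); (OUT₁₃₈-MS) = (OUT₁₃₈) with, IN ADDITION, THE END's multi-scale member of the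
same `Z` at `S₂ξ^{k(2+β)}j^β` — the body of `N16HolderMSPairDefs.PairLandauGaugeB8AvgMS` in (OUT₁₃₈)'s letters.  Threshold: `hol + 2α_{b′}g′ + 8α_{b′}s ≤ S₂`
(`2α_{b′}g′` is the ladder's price, brick 1).  The nearest-neighbour conjunct is the line member at `j = 1`; the Laplacian conjunct is n16-a's verbatim.

WHAT THIS FILE PROVES (kernel, theorems only, 0 `def`, 0 sorry):
§1 `lipMS_AdInv_of_lineBound` — brick 1's `lipMS_AdInv_of_printLetters` with the (3.40) quotient hypothesis replaced by the line bound in the `Ad (hol W y (seg μ j))`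
   letter (the form (OUT_print-MS) carries); `alphaB_le_one` (the (H3ˢᵘᵖ) radius `α_{b′} ≤ 1` under `512(d+1)(d+4)L²b′ ≤ 1`, `L ≥ 2`); `Ad_hol_seg_one` (`j = 1`).
§2 `thm4OutputLandau138MS_of_thm4OutputPrintMS` — (OUT_print-MS) ∧ `LeafH3sup` ⟹ (OUT₁₃₈-MS) at `(S, g′, S₂, β, S₃)`, `0 ≤ β ≤ 1`, `s ≤ S`,
   `hol + 2α_{b′}g′ + 8α_{b′}s ≤ S₂`, `ℓ + 4dα_{b′}s ≤ S₃`.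
HONEST FRAMING: kinematics + bookkeeping; [Balaban1985RegularSpaces] Thm 4 ∕ Prop 3 at curved backgrounds (node N05) NOT proved; N16 ∕ NE3 NOT discharged; count-neutral;
one finite four-torus at fixed ε — NOT ℝ⁴, NOT infinite volume, NOT OS, NOT a mass gap, NOT Clay.
-/

set_option autoImplicit false

open scoped BigOperators Matrix Matrix.Norms.L2Operator
open NormedSpace

namespace Summit.QuantumFields.YangMills.BalabanUVNodes.N16HolderMSPrintLetters

open Literature.MathematicalPhysics.QuantumFieldTheory.Balaban1983to89
open B7Prop1Explicit B7Prop2Explicit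
open T4AveragingDeficitWall (IsUnitaryCfg SmallField Ad)
open T4AveragingDeficitNonAbelian (Ad_mul Ad_sub)
open B8Ineq132 (covDerivFwd)
open B8Eq146AExpansion (iEta)
open B8Eq138LandauZd (covLap IsLandau138)
open B8Lemma1NonAbelian (pert)
open B7Eq92Concrete (mgauge)
open B8Eq184Proof (cfgExp)
open B8Eq119TwistedAxial (Restr129)
open B8Eq166ConstraintPair (ptw)
open B8Thm4TorusAt (torusLam)
open Summit.QuantumFields.BalabanUV.T4Continuum
open AveragingDeficitTransport (norm_Ad_of_unitary mem_U1_of_unitary)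
open AveragingDeficitNearIdentity (Ad_one)
open MinimalActionSandwich (IsMinimiser)
open MinimalActionRate (Regular sfClass rescale_bavg_mem_sfClass)
open NE3.LeafIndexSockets (LeafH3sup)
open NE3EnergyShapes (IsPeriodicSite)
open NE3.PairLandauB8 (covDiff covLapDir)
open NE3.PairLeftChartB8 (norm_iEta)
open N16 (norm_holderDiff_AdInv_le norm_covLapDir_AdInv_le norm_iEta_le)
open N16HolderMSDictionary (norm_holderDiffMS_AdInv_le msError_rpow_bounds)

noncomputable section

variable {d : ℕ} {n : Type*} [Fintype n] [DecidableEq n]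

/-! ## §1 The multi-scale member from the line bound; the (H3ˢᵘᵖ) radius is below one; the one-step holonomy -/

/-- **THE MULTI-SCALE MEMBER OF `Z = Ad_{W⁻¹}(iηA)` FROM THE LINE BOUND** — brick 1's `lipMS_AdInv_of_printLetters` with its (3.40)-quotient hypothesis replaced by the
bound it yields, in the letter (OUT_print-MS) carries: `W` unitary with plaquettes `≤ a ≤ α_W·η²` (`α_W ≤ 1`), `0 < η ≤ 1`, `0 ≤ β ≤ 1`, `‖A‖ ≤ s`, `‖D^η_{W,μ}A_κ‖ ≤ g`,
`‖Ad (hol W y (seg μ j)) (D^η_{W,μ}A_κ)(y+j•e_μ) − (D^η_{W,μ}A_κ)(y)‖ ≤ B·(η·j)^β`, `1 ≤ j`, `j·η ≤ 1` ⟹ the member `≤ (B + 2α_W g + 8α_W s)·η^{2+β}·j^β`.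
[cite: Balaban1985BackgroundPropagators, (3.40) p.397; Balaban1985RegularSpaces, (1.36) p.82] [folklore] -/
theorem lipMS_AdInv_of_lineBound [Nonempty n] {W : Site d → Fin d → (Matrix n n ℂ)ˣ} (hW : IsUnitaryCfg W) {a αW η β s g B : ℝ}
    (hWa : SmallField W a) (haW : a ≤ αW * η ^ 2) (ha : 0 ≤ a) (hαW1 : αW ≤ 1) (hη : 0 < η) (hη1 : η ≤ 1) (hβ0 : 0 ≤ β) (hβ1 : β ≤ 1)
    {A : Site d → Fin d → Matrix n n ℂ} (hs : ∀ x ν, ‖A x ν‖ ≤ s) {μ κ : Fin d}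
    (hg : ∀ z, ‖covDerivFwd η W μ (fun z => A z κ) z‖ ≤ g) {y : Site d} {j : ℕ} (hj : 1 ≤ j) (hjη : (j : ℝ) * η ≤ 1)
    (hB : ‖Ad (hol W y (seg μ (j : ℤ))) (covDerivFwd η W μ (fun z => A z κ) (y + j • e μ)) - covDerivFwd η W μ (fun z => A z κ) y‖ ≤ B * (η * j) ^ β) :
    ‖Ad (((List.range j).map fun i : ℕ => W (y + e κ + i • e μ) μ).prod)
          (Ad (W (y + e κ + j • e μ) μ) ((fun x ν => Ad (W x ν)⁻¹ (iEta η A x ν)) (y + (j + 1) • e μ) κ) -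
            (fun x ν => Ad (W x ν)⁻¹ (iEta η A x ν)) (y + j • e μ) κ) -
        (Ad (W (y + e κ) μ) ((fun x ν => Ad (W x ν)⁻¹ (iEta η A x ν)) (y + e μ) κ) - (fun x ν => Ad (W x ν)⁻¹ (iEta η A x ν)) y κ)‖
      ≤ (B + 2 * αW * g + 8 * αW * s) * η ^ ((2 : ℝ) + β) * (j : ℝ) ^ β := by
  have e1 : Ad (W (y + e κ + j • e μ) μ) ((fun x ν => Ad (W x ν)⁻¹ (iEta η A x ν)) (y + (j + 1) • e μ) κ) -
      (fun x ν => Ad (W x ν)⁻¹ (iEta η A x ν)) (y + j • e μ) κ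
      = covDiff W μ (fun x ν => Ad (W x ν)⁻¹ (iEta η A x ν)) (y + j • e μ) κ := by
    unfold covDiff
    rw [show y + e κ + j • e μ = y + j • e μ + e κ by abel, show y + (j + 1) • e μ = y + j • e μ + e μ by rw [succ_nsmul, add_assoc]]
  have e0 : Ad (W (y + e κ) μ) ((fun x ν => Ad (W x ν)⁻¹ (iEta η A x ν)) (y + e μ) κ) - (fun x ν => Ad (W x ν)⁻¹ (iEta η A x ν)) y κ
      = covDiff W μ (fun x ν => Ad (W x ν)⁻¹ (iEta η A x ν)) y κ := rfl
  rw [e1, e0]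
  have h := norm_holderDiffMS_AdInv_le hW ha hWa hη A μ y κ j
  have hYj : ‖iEta η A (y + j • e μ + e μ) κ‖ ≤ η * s := by
    rw [norm_iEta hη.le]; exact mul_le_mul_of_nonneg_left (hs _ _) hη.le
  have hY1 : ‖iEta η A (y + e μ) κ‖ ≤ η * s := by
    rw [norm_iEta hη.le]; exact mul_le_mul_of_nonneg_left (hs _ _) hη.le
  have hgj := hg (y + j • e μ)
  obtain ⟨hb4, hb3, hb5⟩ := msError_rpow_bounds hη hη1 hj hjη hβ0 hβ1
  have hαW0 : 0 ≤ αW := by nlinarith [pow_pos hη 2]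
  have hs0 : 0 ≤ s := (norm_nonneg _).trans (hs y κ)
  have hg0 : 0 ≤ g := (norm_nonneg _).trans (hg y)
  have hj0 : (0 : ℝ) ≤ j := Nat.cast_nonneg j
  have hηj : (η * j) ^ β = η ^ β * (j : ℝ) ^ β := Real.mul_rpow hη.le hj0
  set R : ℝ := η ^ ((2 : ℝ) + β) * (j : ℝ) ^ β with hRdef
  have hR : R = η ^ 2 * (η ^ β * (j : ℝ) ^ β) := by
    rw [hRdef, Real.rpow_add hη, show (2 : ℝ) = ((2 : ℕ) : ℝ) by norm_num, Real.rpow_natCast]; ring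
  have hR0 : 0 ≤ R := mul_nonneg (Real.rpow_nonneg hη.le _) (Real.rpow_nonneg hj0 _)
  have t1 : η ^ 2 * ‖Ad (hol W y (seg μ (j : ℤ))) (covDerivFwd η W μ (fun z => A z κ) (y + j • e μ)) - covDerivFwd η W μ (fun z => A z κ) y‖
      ≤ B * R := by
    calc _ ≤ η ^ 2 * (B * (η * j) ^ β) := mul_le_mul_of_nonneg_left hB (by positivity)
      _ = B * R := by rw [hR, hηj]; ring
  have t2 : 2 * (j * a) * (η ^ 2 * ‖covDerivFwd η W μ (fun z => A z κ) (y + j • e μ)‖ + 2 * a * ‖iEta η A (y + j • e μ + e μ) κ‖)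
      ≤ 2 * αW * g * R + 4 * αW * s * R := by
    have i1 : 2 * (j * a) * (η ^ 2 * ‖covDerivFwd η W μ (fun z => A z κ) (y + j • e μ)‖) ≤ 2 * αW * g * ((j : ℝ) * η ^ 4) := by
      have : 2 * αW * g * ((j : ℝ) * η ^ 4) = 2 * (j * (αW * η ^ 2)) * (η ^ 2 * g) := by ring
      rw [this]
      exact mul_le_mul (mul_le_mul_of_nonneg_left (mul_le_mul_of_nonneg_left haW hj0) (by norm_num))
        (mul_le_mul_of_nonneg_left hgj (by positivity)) (by positivity) (by positivity)
    have i2 : 2 * (j * a) * (2 * a * ‖iEta η A (y + j • e μ + e μ) κ‖) ≤ 4 * αW * s * ((j : ℝ) * η ^ 5) := by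
      have e : 4 * αW * s * ((j : ℝ) * η ^ 5) = 2 * (j * (αW * η ^ 2)) * (2 * (1 * η ^ 2) * (η * s)) := by ring
      rw [e]
      have ha2 : a ≤ 1 * η ^ 2 := haW.trans (by nlinarith [pow_pos hη 2])
      exact mul_le_mul (mul_le_mul_of_nonneg_left (mul_le_mul_of_nonneg_left haW hj0) (by norm_num))
        (mul_le_mul (mul_le_mul_of_nonneg_left ha2 (by norm_num)) hYj (norm_nonneg _) (by positivity)) (by positivity) (by positivity)
    rw [mul_add]
    refine add_le_add (i1.trans ?_) (i2.trans ?_)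
    · exact mul_le_mul_of_nonneg_left hb4 (by positivity)
    · exact mul_le_mul_of_nonneg_left hb5 (by positivity)
  have t3 : 2 * a * ‖iEta η A (y + j • e μ + e μ) κ‖ + 2 * a * ‖iEta η A (y + e μ) κ‖ ≤ 4 * αW * s * R := by
    have i3 : 2 * a * ‖iEta η A (y + j • e μ + e μ) κ‖ + 2 * a * ‖iEta η A (y + e μ) κ‖ ≤ 4 * αW * s * η ^ 3 := by
      have e : 4 * αW * s * η ^ 3 = 2 * (αW * η ^ 2) * (η * s) + 2 * (αW * η ^ 2) * (η * s) := by ring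
      rw [e]
      exact add_le_add (mul_le_mul (mul_le_mul_of_nonneg_left haW (by norm_num)) hYj (norm_nonneg _) (by positivity))
        (mul_le_mul (mul_le_mul_of_nonneg_left haW (by norm_num)) hY1 (norm_nonneg _) (by positivity))
    exact i3.trans (mul_le_mul_of_nonneg_left hb3 (by positivity))
  calc _ ≤ _ := h
    _ ≤ B * R + (2 * αW * g * R + 4 * αW * s * R) + 4 * αW * s * R := add_le_add (add_le_add t1 t2) t3
    _ = (B + 2 * αW * g + 8 * αW * s) * R := by ring
    _ = (B + 2 * αW * g + 8 * αW * s) * η ^ ((2 : ℝ) + β) * (j : ℝ) ^ β := by rw [hRdef]; ring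

/-- **THE (H3ˢᵘᵖ) RADIUS IS BELOW ONE**: `512(d+1)(d+4)L²b′ ≤ 1`, `L ≥ 2`, `b′ ≥ 0` ⇒ `α_{b′} = b′ + 226(8(d+1)(d+4))²b′² ≤ 1`. [folklore] -/
theorem alphaB_le_one {L : ℕ} (hL : 2 ≤ L) {b' : ℝ} (hb' : 0 ≤ b') (hbs' : 512 * (d + 1) * (d + 4) * (L : ℝ) ^ 2 * b' ≤ 1) :
    b' + 226 * (8 * (d + 1) * (d + 4)) ^ 2 * b' ^ 2 ≤ 1 := by
  have hL2 : (2 : ℝ) ≤ L := by exact_mod_cast hL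
  have hL4 : (4 : ℝ) ≤ (L : ℝ) ^ 2 := by nlinarith
  have hd0 : (0 : ℝ) ≤ d := Nat.cast_nonneg d
  set t : ℝ := ((d : ℝ) + 1) * ((d : ℝ) + 4) * b' with ht
  have ht0 : 0 ≤ t := by positivity
  have hD1 : (1 : ℝ) ≤ ((d : ℝ) + 1) * ((d : ℝ) + 4) := by nlinarith
  -- `512·L²·t ≤ 1`, `L² ≥ 4` ⇒ `t ≤ 1∕2048`
  have h1 : 512 * (L : ℝ) ^ 2 * t ≤ 1 := by rw [ht]; linarith [hbs']
  have ht1 : t ≤ 1 / 2048 := by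
    have : 512 * 4 * t ≤ 512 * (L : ℝ) ^ 2 * t := by nlinarith
    linarith
  have hb1 : b' ≤ t := by
    rw [ht]; nlinarith
  have e : 226 * (8 * ((d : ℝ) + 1) * ((d : ℝ) + 4)) ^ 2 * b' ^ 2 = 226 * 64 * t ^ 2 := by rw [ht]; ring
  rw [e]
  nlinarith

/-- The word holonomy of the one-step segment is the bond variable: `hol W y (seg μ 1) = W y μ`. [folklore] -/
theorem hol_seg_one (W : Site d → Fin d → (Matrix n n ℂ)ˣ) (y : Site d) (μ : Fin d) : hol W y (seg μ ((1 : ℕ) : ℤ)) = W y μ := by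
  rw [seg_natCast, List.replicate_one, hol_cons, hol_nil, mul_one, stepHol_true]

/-! ## §2 (OUT_print-MS) ⟹ (OUT₁₃₈-MS) -/

set_option maxHeartbeats 400000 in
/-- **THEOREM 4's OUTPUT AT THE PAIR IN PRINT's LETTERS, HÖLDER LINE MULTI-SCALE, IMPLIES THE END's EDGE BINDER WITH THE MULTI-SCALE MEMBER** (any `d`; `L ≥ 2`;
class regularity letter `b′ ≥ 0` with `512(d+1)(d+4)L²b′ ≤ 1`; `0 ≤ β ≤ 1`).  (OUT_print-MS) = n16-a's (OUT_print) with the (1.36)₃ line read along every lattice line: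
`‖Ad_{W(Γ_{y,y+j e_μ})}(D^η_{W,μ}A_κ)(y+j•e_μ) − D^η_{W,μ}A_κ(y)‖ ≤ bh·ξ^{kβ}·j^β` for `1 ≤ j ≤ L^k` (`W(Γ) = hol W y (seg μ j)`, `η = (Lᵏ)⁻¹ = ξ^k`).  CONCLUSION
(OUT₁₃₈-MS) = n16-a's (OUT₁₃₈) at `(S, g′, S₂, β, S₃)` PLUS THE END's multi-scale member of `Z = Ad_{W⁻¹}(iηA)` at `S₂ξ^{k(2+β)}j^β` (the body of
`N16HolderMSPairDefs.PairLandauGaugeB8AvgMS` in these letters); thresholds `s ≤ S`, `bh + 2α_{b′}g′ + 8α_{b′}s ≤ S₂`, `ℓ + 4dα_{b′}s ≤ S₃`.  The nearest-neighbour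
conjunct is the line at `j = 1` through n16-a's `norm_holderDiff_AdInv_le`; the multi-scale conjunct is §1 over brick 1; the Laplacian conjunct is n16-a's verbatim.
[cite: Balaban1985RegularSpaces, (1.36) p.82, (1.39) p.83; Balaban1985BackgroundPropagators, (3.40) p.397] [folklore] -/
theorem thm4OutputLandau138MS_of_thm4OutputPrintMS [Nonempty n] {L N : ℕ} (hL : 2 ≤ L) {ε b g b' c' s g' bh ℓ β S S₂ S₃ : ℝ}
    (hb' : 0 ≤ b') (hbs' : 512 * (d + 1) * (d + 4) * (L : ℝ) ^ 2 * b' ≤ 1) (hβ0 : 0 ≤ β) (hβ : β ≤ 1) (hS : s ≤ S)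
    (hS₂ : bh + 2 * (b' + 226 * (8 * (d + 1) * (d + 4)) ^ 2 * b' ^ 2) * g' + 8 * (b' + 226 * (8 * (d + 1) * (d + 4)) ^ 2 * b' ^ 2) * s ≤ S₂)
    (hS₃ : ℓ + 4 * d * (b' + 226 * (8 * (d + 1) * (d + 4)) ^ 2 * b' ^ 2) * s ≤ S₃)
    {dom : Set (Site d → Fin d → (Matrix n n ℂ)ˣ)}
    (hOut :
      ∀ k : ℕ, 1 ≤ k → ∀ V ∈ dom, ∀ UA UB : Site d → Fin d → (Matrix n n ℂ)ˣ,
        IsMinimiser d (sfClass d L N ε) L N k V UA → IsMinimiser d (sfClass d L N ε) L N (k + 1) V UB → Regular d L N b g (k + 1) UB →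
        ∃ u : Site d → (Matrix n n ℂ)ˣ, (∀ x, u x ∈ unitaryUnits (Matrix n n ℂ)) ∧ IsPeriodicSite u (((N * L ^ k : ℕ) : ℤ)) ∧
          (∃ Λ : ℕ → Set (Site d), Λ k = Set.univ ∧ Restr129 L k Λ (rescale L (bavg L UB)) u) ∧
          ∃ A : Site d → Fin d → Matrix n n ℂ,
            (∀ x μ, IsSelfAdjoint (A x μ)) ∧ (∀ (x : Site d) (κ μ : Fin d), A (x + (((N * L ^ k : ℕ) : ℤ)) • e κ) μ = A x μ) ∧
            mgauge (rescale L (bavg L UB)) u (cfgExp (((L : ℝ) ^ k)⁻¹) A)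
              = pert (gaugeAct (ptw L (rescale L (bavg L UB)) UA k) UA) (rescale L (bavg L UB)) ∧
            (∀ x μ, ‖A x μ‖ ≤ s) ∧
            (∀ (μ : Fin d) (x : Site d) (κ : Fin d), ‖covDerivFwd (((L : ℝ) ^ k)⁻¹) (rescale L (bavg L UB)) μ (fun z => A z κ) x‖ ≤ g') ∧
            IsLandau138 L k (((L : ℝ) ^ k)⁻¹) Set.univ (torusLam k) (rescale L (bavg L UB)) A ∧
            (∀ (κ μ : Fin d) (y : Site d) (j : ℕ), 1 ≤ j → j ≤ L ^ k →
              ‖Ad (hol (rescale L (bavg L UB)) y (seg μ (j : ℤ)))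
                  (covDerivFwd (((L : ℝ) ^ k)⁻¹) (rescale L (bavg L UB)) μ (fun z => A z κ) (y + j • e μ))
                - covDerivFwd (((L : ℝ) ^ k)⁻¹) (rescale L (bavg L UB)) μ (fun z => A z κ) y‖
                ≤ bh * ((((L : ℝ)⁻¹) ^ k) ^ β * (j : ℝ) ^ β)) ∧
            (∀ (x : Site d) (κ : Fin d), ‖covLap (((L : ℝ) ^ k)⁻¹) (rescale L (bavg L UB)) (fun z => A z κ) x‖ ≤ ℓ))
    (h3 : LeafH3sup d L N ε b' c' dom) :
    ∀ k : ℕ, 1 ≤ k → ∀ V ∈ dom, ∀ UA UB : Site d → Fin d → (Matrix n n ℂ)ˣ,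
      IsMinimiser d (sfClass d L N ε) L N k V UA → IsMinimiser d (sfClass d L N ε) L N (k + 1) V UB → Regular d L N b g (k + 1) UB →
      ∃ u : Site d → (Matrix n n ℂ)ˣ, (∀ x, u x ∈ unitaryUnits (Matrix n n ℂ)) ∧ IsPeriodicSite u (((N * L ^ k : ℕ) : ℤ)) ∧
        (∃ Λ : ℕ → Set (Site d), Λ k = Set.univ ∧ Restr129 L k Λ (rescale L (bavg L UB)) u) ∧
        ∃ A : Site d → Fin d → Matrix n n ℂ,
          (∀ x μ, IsSelfAdjoint (A x μ)) ∧ (∀ (x : Site d) (κ μ : Fin d), A (x + (((N * L ^ k : ℕ) : ℤ)) • e κ) μ = A x μ) ∧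
          mgauge (rescale L (bavg L UB)) u (cfgExp (((L : ℝ) ^ k)⁻¹) A)
            = pert (gaugeAct (ptw L (rescale L (bavg L UB)) UA k) UA) (rescale L (bavg L UB)) ∧
          (∀ x μ, ‖A x μ‖ ≤ S) ∧
          (∀ (μ : Fin d) (x : Site d) (κ : Fin d), ‖covDerivFwd (((L : ℝ) ^ k)⁻¹) (rescale L (bavg L UB)) μ (fun z => A z κ) x‖ ≤ g') ∧
          IsLandau138 L k (((L : ℝ) ^ k)⁻¹) Set.univ (torusLam k) (rescale L (bavg L UB)) A ∧
          (∀ (κ μ : Fin d) (y : Site d),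
            ‖Ad (rescale L (bavg L UB) (y + e κ) μ)
                (Ad (rescale L (bavg L UB) (y + e κ + e μ) μ)
                    ((fun x μ => Ad (rescale L (bavg L UB) x μ)⁻¹ (iEta (((L : ℝ) ^ k)⁻¹) A x μ)) (y + (2 : ℕ) • e μ) κ)
                  - (fun x μ => Ad (rescale L (bavg L UB) x μ)⁻¹ (iEta (((L : ℝ) ^ k)⁻¹) A x μ)) (y + e μ) κ)
              - (Ad (rescale L (bavg L UB) (y + e κ) μ) ((fun x μ => Ad (rescale L (bavg L UB) x μ)⁻¹ (iEta (((L : ℝ) ^ k)⁻¹) A x μ)) (y + e μ) κ)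
                - (fun x μ => Ad (rescale L (bavg L UB) x μ)⁻¹ (iEta (((L : ℝ) ^ k)⁻¹) A x μ)) y κ)‖
              ≤ S₂ * (((L : ℝ)⁻¹) ^ k) ^ ((2 : ℝ) + β)) ∧
          (∀ (κ μ : Fin d) (y : Site d) (j : ℕ), 1 ≤ j → j ≤ L ^ k →
            ‖Ad (((List.range j).map fun i : ℕ => rescale L (bavg L UB) (y + e κ + i • e μ) μ).prod)
                  (Ad (rescale L (bavg L UB) (y + e κ + j • e μ) μ)
                      ((fun x μ => Ad (rescale L (bavg L UB) x μ)⁻¹ (iEta (((L : ℝ) ^ k)⁻¹) A x μ)) (y + (j + 1) • e μ) κ)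
                    - (fun x μ => Ad (rescale L (bavg L UB) x μ)⁻¹ (iEta (((L : ℝ) ^ k)⁻¹) A x μ)) (y + j • e μ) κ)
              - (Ad (rescale L (bavg L UB) (y + e κ) μ) ((fun x μ => Ad (rescale L (bavg L UB) x μ)⁻¹ (iEta (((L : ℝ) ^ k)⁻¹) A x μ)) (y + e μ) κ)
                - (fun x μ => Ad (rescale L (bavg L UB) x μ)⁻¹ (iEta (((L : ℝ) ^ k)⁻¹) A x μ)) y κ)‖
              ≤ S₂ * (((L : ℝ)⁻¹) ^ k) ^ ((2 : ℝ) + β) * (j : ℝ) ^ β) ∧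
          (∀ (x : Site d) (κ : Fin d),
            ‖covLapDir (rescale L (bavg L UB)) (fun x μ => Ad (rescale L (bavg L UB) x μ)⁻¹ (iEta (((L : ℝ) ^ k)⁻¹) A x μ)) x κ‖
              ≤ S₃ * (((L : ℝ)⁻¹) ^ k) ^ 3) := by
  intro k hk V hV UA UB hA hB hreg
  have hL1 : 1 ≤ L := le_trans (by norm_num) hL
  have hL1r : (1 : ℝ) ≤ L := by exact_mod_cast hL1
  have hLk : (1 : ℝ) ≤ (L : ℝ) ^ k := one_le_pow₀ hL1r
  have hLk1 : 1 ≤ L ^ k := Nat.one_le_pow k L (by omega)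
  obtain ⟨u, hu, huP, hres, A, hAsa, hAP, hmg, hs, hg, h138, hMS, hlap⟩ := hOut k hk V hV UA UB hA hB hreg
  -- the pair's background ((H3ˢᵘᵖ) at `U_B`): unitary, periodic, plaquettes within `a = α_{b′}·η²` of `1`
  have hαb0 : 0 ≤ (b' + 226 * (8 * (d + 1) * (d + 4)) ^ 2 * b' ^ 2) := by positivity
  have hαb1 : (b' + 226 * (8 * (d + 1) * (d + 4)) ^ 2 * b' ^ 2) ≤ 1 := alphaB_le_one hL hb' hbs'
  obtain ⟨hWu, -, hWsm⟩ := rescale_bavg_mem_sfClass hL1 hb' hbs' le_rfl (h3 V hV k UB hB).regular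
  have ha : 0 ≤ (b' + 226 * (8 * (d + 1) * (d + 4)) ^ 2 * b' ^ 2) / ((L : ℝ) ^ k) ^ 2 := div_nonneg hαb0 (by positivity)
  have hη : (0 : ℝ) < ((L : ℝ) ^ k)⁻¹ := by positivity
  have hηk : ((L : ℝ) ^ k)⁻¹ = ((L : ℝ)⁻¹) ^ k := (inv_pow _ _).symm
  have hη1 : ((L : ℝ) ^ k)⁻¹ ≤ 1 := inv_le_one_of_one_le₀ hLk
  have ha' : (b' + 226 * (8 * (d + 1) * (d + 4)) ^ 2 * b' ^ 2) / ((L : ℝ) ^ k) ^ 2 = (b' + 226 * (8 * (d + 1) * (d + 4)) ^ 2 * b' ^ 2) * (((L : ℝ) ^ k)⁻¹) ^ 2 := by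
    rw [div_eq_mul_inv, inv_pow]
  -- the nearest-neighbour line is the multi-scale line at `j = 1`
  have hhol : ∀ (μ : Fin d) (y : Site d) (κ : Fin d),
      ‖Ad (rescale L (bavg L UB) y μ) (covDerivFwd (((L : ℝ) ^ k)⁻¹) (rescale L (bavg L UB)) μ (fun z => A z κ) (y + e μ))
        - covDerivFwd (((L : ℝ) ^ k)⁻¹) (rescale L (bavg L UB)) μ (fun z => A z κ) y‖ ≤ bh * (((L : ℝ)⁻¹) ^ k) ^ β := by
    intro μ y κ
    have h1 := hMS κ μ y 1 le_rfl hLk1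
    rwa [hol_seg_one, one_smul, Nat.cast_one, Real.one_rpow, mul_one] at h1
  refine ⟨u, hu, huP, hres, A, hAsa, hAP, hmg, fun x μ => (hs x μ).trans hS, hg, h138, fun κ μ y => ?_, fun κ μ y j hj hjL => ?_, fun x κ => ?_⟩
  · -- the nearest-neighbour Hölder member (n16-a §2, verbatim)
    have hs0 : 0 ≤ s := (norm_nonneg _).trans (hs y κ)
    have hg0 : 0 ≤ g' := (norm_nonneg _).trans (hg μ y κ)
    have hS₂' : bh + 8 * (b' + 226 * (8 * (d + 1) * (d + 4)) ^ 2 * b' ^ 2) * s ≤ S₂ := by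
      have : 0 ≤ 2 * (b' + 226 * (8 * (d + 1) * (d + 4)) ^ 2 * b' ^ 2) * g' := by positivity
      linarith
    have e1 : y + e κ + e μ = y + e μ + e κ := add_right_comm _ _ _
    have e2 : y + (2 : ℕ) • e μ = y + e μ + e μ := by rw [two_nsmul, add_assoc]
    rw [e1, e2]
    show ‖Ad (rescale L (bavg L UB) (y + e κ) μ) (covDiff (rescale L (bavg L UB)) μ (fun x μ => Ad (rescale L (bavg L UB) x μ)⁻¹ (iEta (((L : ℝ) ^ k)⁻¹) A x μ)) (y + e μ) κ) -
        covDiff (rescale L (bavg L UB)) μ (fun x μ => Ad (rescale L (bavg L UB) x μ)⁻¹ (iEta (((L : ℝ) ^ k)⁻¹) A x μ)) y κ‖ ≤ _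
    refine (norm_holderDiff_AdInv_le hWu ha hWsm hη A μ y κ).trans ?_
    have hY2 := norm_iEta_le hη.le hs (y + e μ + e μ) κ
    have hY1 := norm_iEta_le hη.le hs (y + e μ) κ
    have hH := hhol μ y κ
    rw [← hηk] at hH ⊢
    have hpow : (((L : ℝ) ^ k)⁻¹) ^ 2 * (((L : ℝ) ^ k)⁻¹) ^ β = (((L : ℝ) ^ k)⁻¹) ^ ((2 : ℝ) + β) := by
      rw [Real.rpow_add hη, Real.rpow_two]
    have hpow3 : (((L : ℝ) ^ k)⁻¹) ^ 3 ≤ (((L : ℝ) ^ k)⁻¹) ^ ((2 : ℝ) + β) := by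
      have h := Real.rpow_le_rpow_of_exponent_ge hη hη1 (by linarith : (2 : ℝ) + β ≤ 3)
      rwa [show ((3 : ℝ)) = ((3 : ℕ) : ℝ) by norm_num, Real.rpow_natCast] at h
    have hηβ0 : 0 ≤ (((L : ℝ) ^ k)⁻¹) ^ β := Real.rpow_nonneg hη.le _
    have h2 : (((L : ℝ) ^ k)⁻¹) ^ 2 * ‖Ad (rescale L (bavg L UB) y μ) (covDerivFwd (((L : ℝ) ^ k)⁻¹) (rescale L (bavg L UB)) μ (fun z => A z κ) (y + e μ)) -
        covDerivFwd (((L : ℝ) ^ k)⁻¹) (rescale L (bavg L UB)) μ (fun z => A z κ) y‖ ≤ bh * (((L : ℝ) ^ k)⁻¹) ^ ((2 : ℝ) + β) := by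
      rw [← hpow, mul_comm bh, mul_assoc]
      exact mul_le_mul_of_nonneg_left (by rw [mul_comm]; exact hH) (by positivity)
    have h3' : 4 * ((b' + 226 * (8 * (d + 1) * (d + 4)) ^ 2 * b' ^ 2) / ((L : ℝ) ^ k) ^ 2) * ‖iEta (((L : ℝ) ^ k)⁻¹) A (y + e μ + e μ) κ‖ +
        4 * ((b' + 226 * (8 * (d + 1) * (d + 4)) ^ 2 * b' ^ 2) / ((L : ℝ) ^ k) ^ 2) * ‖iEta (((L : ℝ) ^ k)⁻¹) A (y + e μ) κ‖ ≤
        8 * (b' + 226 * (8 * (d + 1) * (d + 4)) ^ 2 * b' ^ 2) * s * (((L : ℝ) ^ k)⁻¹) ^ ((2 : ℝ) + β) := by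
      rw [ha']
      have h4 : 4 * ((b' + 226 * (8 * (d + 1) * (d + 4)) ^ 2 * b' ^ 2) * (((L : ℝ) ^ k)⁻¹) ^ 2) * ‖iEta (((L : ℝ) ^ k)⁻¹) A (y + e μ + e μ) κ‖ +
          4 * ((b' + 226 * (8 * (d + 1) * (d + 4)) ^ 2 * b' ^ 2) * (((L : ℝ) ^ k)⁻¹) ^ 2) * ‖iEta (((L : ℝ) ^ k)⁻¹) A (y + e μ) κ‖ ≤
          8 * (b' + 226 * (8 * (d + 1) * (d + 4)) ^ 2 * b' ^ 2) * s * (((L : ℝ) ^ k)⁻¹) ^ 3 := by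
        have := mul_le_mul_of_nonneg_left hY2 (by positivity : (0 : ℝ) ≤ 4 * ((b' + 226 * (8 * (d + 1) * (d + 4)) ^ 2 * b' ^ 2) * (((L : ℝ) ^ k)⁻¹) ^ 2))
        have := mul_le_mul_of_nonneg_left hY1 (by positivity : (0 : ℝ) ≤ 4 * ((b' + 226 * (8 * (d + 1) * (d + 4)) ^ 2 * b' ^ 2) * (((L : ℝ) ^ k)⁻¹) ^ 2))
        nlinarith
      exact h4.trans (mul_le_mul_of_nonneg_left hpow3 (by positivity))
    have hS₂'' := mul_le_mul_of_nonneg_right hS₂' (Real.rpow_nonneg hη.le ((2 : ℝ) + β))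
    nlinarith [h2, h3', hS₂'']
  · -- the multi-scale member (§1 over brick 1)
    have hjη : (j : ℝ) * ((L : ℝ) ^ k)⁻¹ ≤ 1 := by
      have hjr : (j : ℝ) ≤ (L : ℝ) ^ k := by exact_mod_cast hjL
      rw [← div_eq_mul_inv, div_le_one (by positivity)]
      exact hjr
    have hB : ‖Ad (hol (rescale L (bavg L UB)) y (seg μ (j : ℤ)))
          (covDerivFwd (((L : ℝ) ^ k)⁻¹) (rescale L (bavg L UB)) μ (fun z => A z κ) (y + j • e μ))
        - covDerivFwd (((L : ℝ) ^ k)⁻¹) (rescale L (bavg L UB)) μ (fun z => A z κ) y‖ ≤ bh * ((((L : ℝ) ^ k)⁻¹) * j) ^ β := by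
      have h1 := hMS κ μ y j hj hjL
      rw [← hηk] at h1
      rw [Real.mul_rpow hη.le (Nat.cast_nonneg j)]
      exact h1
    have h := lipMS_AdInv_of_lineBound (W := rescale L (bavg L UB)) hWu hWsm (le_of_eq ha') ha hαb1 hη hη1 hβ0 hβ hs (μ := μ) (κ := κ)
      (fun z => hg μ z κ) hj hjη hB
    refine h.trans ?_
    rw [hηk]
    have hR0 : 0 ≤ (((L : ℝ)⁻¹) ^ k) ^ ((2 : ℝ) + β) * (j : ℝ) ^ β :=
      mul_nonneg (Real.rpow_nonneg (pow_nonneg (inv_nonneg.mpr (Nat.cast_nonneg L)) k) _) (Real.rpow_nonneg (Nat.cast_nonneg j) _)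
    nlinarith [mul_le_mul_of_nonneg_right hS₂ hR0]
  · -- the Laplacian member (n16-a §1, verbatim)
    refine (norm_covLapDir_AdInv_le hWu ha hWsm hη A x κ).trans ?_
    have hs0 : 0 ≤ s := (norm_nonneg _).trans (hs x κ)
    have hsum : ∑ μ : Fin d, (‖iEta (((L : ℝ) ^ k)⁻¹) A (x + e μ) κ‖ + ‖iEta (((L : ℝ) ^ k)⁻¹) A (x - e μ) κ‖) ≤
        ∑ _μ : Fin d, 2 * ((((L : ℝ) ^ k)⁻¹) * s) :=
      Finset.sum_le_sum fun μ _ => by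
        have h1 := norm_iEta_le hη.le hs (x + e μ) κ
        have h2 := norm_iEta_le hη.le hs (x - e μ) κ
        linarith
    rw [Finset.sum_const, Finset.card_univ, Fintype.card_fin, nsmul_eq_mul] at hsum
    rw [← hηk, ha']
    have hl := hlap x κ
    have hη3 : 0 ≤ (((L : ℝ) ^ k)⁻¹) ^ 3 := by positivity
    have e3 : (ℓ + 4 * d * (b' + 226 * (8 * (d + 1) * (d + 4)) ^ 2 * b' ^ 2) * s) * (((L : ℝ) ^ k)⁻¹) ^ 3 =
        (((L : ℝ) ^ k)⁻¹) ^ 3 * ℓ + 2 * ((b' + 226 * (8 * (d + 1) * (d + 4)) ^ 2 * b' ^ 2) * (((L : ℝ) ^ k)⁻¹) ^ 2) * ((d : ℝ) * (2 * ((((L : ℝ) ^ k)⁻¹) * s))) := by ring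
    refine le_trans ?_ (mul_le_mul_of_nonneg_right hS₃ hη3)
    rw [e3]
    exact add_le_add (mul_le_mul_of_nonneg_left hl hη3) (mul_le_mul_of_nonneg_left hsum (by positivity))

end

end Summit.QuantumFields.YangMills.BalabanUVNodes.N16HolderMSPrintLetters
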